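import Mathlib
import HarnessLib
import Summits.RiemannHypothesis.RiemannHypothesis.Theses.WeilParity

/-!
# Route WeilParity: the range glue (item 15434)

`ParityGlue` (stmt-RiemannHypothesis-15434): the two window ranges give the target —
`EvenWinsArch → EvenWinsBeyondArch → EvenSectorWins` (case split at `a = (log 2)/2`; recorded as
proved in the planner's Sketch.lean).  Axioms: propext, Classical.choice, Quot.sound.
-/

namespace Summit.RiemannHypothesis.RiemannHypothesis.Theorems.WeilParity

open Summit.RiemannHypothesis.RiemannHypothesis.Theses.WeilParity

/-- **Item stmt-RiemannHypothesis-15434** (`ParityGlue`): the prime-free range `EvenWinsArch`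
(`0 < a ≤ (log 2)/2`) and the rest `EvenWinsBeyondArch` (`a > (log 2)/2`) give `EvenSectorWins`
(every `a > 0`). [folklore] -/
theorem parityGlue_proof :
    Summit.RiemannHypothesis.RiemannHypothesis.Theses.WeilParity.ParityGlue := by
  intro hArch hBeyond a ha o ho hos hodd hon δ hδ
  rcases le_or_gt a (Real.log 2 / 2) with hle | hlt
  · exact hArch a ha hle o ho hos hodd hon δ hδ
  · exact hBeyond a hlt o ho hos hodd hon δ hδ

end Summit.RiemannHypothesis.RiemannHypothesis.Theorems.WeilParity
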